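import Literature.MathematicalPhysics.KineticTheory.LangevinChainH2Proof
import Literature.MathematicalPhysics.KineticTheory.LangevinChainHormander
import Literature.Analysis.Hypoelliptic.HormanderProof
import HarnessLib

/-!
# The Lyapunov fact of CEHR 2018 for the pinned chain, discharged

Trunk T-KINETIC (Literature/MathematicalPhysics/KineticTheory). Provefact unit for the named fact
`CuneoEckmannHairerReyBellet2018_lyapunov` (`LangevinChainLyapunov.lean`): Cuneo–Eckmann–Hairer–
Rey-Bellet, *Non-equilibrium steady states for networks of oscillators*, EJP 23 (2018) no. 55
(arXiv:1712.09413), §3 p. 7 eq. (3.4), p. 9 ("the process is Feller"), Theorem 5.1 and Remark 5.2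
(the Lyapunov condition H2 for `V = e^{θH}`, `0 < θ < 1/max(T_L,T_R)`, every `t* > 0`).

The witness is the transition semigroup `pinnedChainSemigroup` of the pinned chain constructed in
the tree (`LangevinChainKernel.lean`, `LangevinChainDynkin.lean`): it is Feller
(`continuous_act_pinnedChainSemigroup`), satisfies the a-priori bound (3.4)
(`lintegral_exp_mul_hamiltonian_pinnedChainSemigroup_le`, `LangevinChainExpBound.lean`), and
satisfies H2 — the named fact `CuneoEckmannHairerReyBellet2018_H2` of `LangevinChainDynkin.lean`,
discharged in `LangevinChainH2Proof.lean` (`CuneoEckmannHairerReyBellet2018_H2_holds`, CEHR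
Thm 5.1 / Rem 5.2 through the pathwise high-energy dissipation estimates of Prop. 5.3 in both
regimes of §5.1–§5.2). The glue is `CuneoEckmannHairerReyBellet2018_lyapunov_of_H2`
(`LangevinChainDynkin.lean`). A sibling file rather than an append to `LangevinChainLyapunov.lean`,
which is imported (through `LangevinChainExpBound.lean`) by the modules proving H2.

Second discharge in this file (provefact unit
`Literature.MathematicalPhysics.KineticTheory.HeatConduction.CuneoEckmannHairerReyBellet2018_smoothDensity`):
the smooth-density fact `CuneoEckmannHairerReyBellet2018_smoothDensity` of `LangevinChainLyapunov.lean`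
(stationary measures of the pinned chain have a `C^∞` density; CEHR 2018 around Prop. 4.1, via
Hörmander's theorem) was reduced in `LangevinChainHormander.lean`
(`CuneoEckmannHairerReyBellet2018_smoothDensity_of_hormander`, CEHR Prop. 4.1 proved there) to
Hörmander's hypoellipticity theorem `Literature.Analysis.Distribution.Hormander1967_thm11`
(L. Hörmander, Acta Math. 119 (1967), Thm 1.1), now PROVED by Kohn's Fourier-side method
(`Literature.Analysis.Hypoelliptic.hormander1967_thm11_proof`, `Literature/Analysis/Hypoelliptic/`).

## References

* N. Cuneo, J.-P. Eckmann, M. Hairer, L. Rey-Bellet, *Non-equilibrium steady states for networks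
  of oscillators*, EJP 23 (2018) no. 55 (arXiv:1712.09413): §3 eq. (3.4) and p. 9, Thm 5.1,
  Rem 5.2; Prop. 4.1.
* L. Hörmander, *Hypoelliptic second order differential equations*, Acta Math. 119 (1967), Thm 1.1.
-/

namespace Literature.MathematicalPhysics.KineticTheory.HeatConduction

/-- **Cuneo–Eckmann–Hairer–Rey-Bellet 2018, §3 eq. (3.4) with Theorem 5.1 / Remark 5.2, for the
pinned chain — the named fact `CuneoEckmannHairerReyBellet2018_lyapunov` DISCHARGED**: for
`ω₂, β, γ > 0`, `lam ≥ 0`, `N ≥ 1`, `T_L, T_R > 0` there is a Feller Markov semigroup of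
`pinnedChain ω₂ lam β γ` (namely its transition semigroup `pinnedChainSemigroup`) such that for
every `0 < θ < 1/max(T_L,T_R)`: (3.4) `E_z e^{θH(z_t)} ≤ e^{θγ(T_L+T_R)t} e^{θH(z)}` for all `t, z`,
and for every `t* > 0` the Lyapunov condition H2 `E_z e^{θH(z_{t*})} ≤ κ e^{θH(z)} + c 1_K(z)` with
`κ ∈ (0,1)`, `c > 0`, `K` compact.
[cite: CuneoEckmannHairerReyBellet2018, Thm 5.1, Rem 5.2 and §3 eq. (3.4)] -/
theorem CuneoEckmannHairerReyBellet2018_lyapunov_holds : CuneoEckmannHairerReyBellet2018_lyapunov :=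
  CuneoEckmannHairerReyBellet2018_lyapunov_of_H2 CuneoEckmannHairerReyBellet2018_H2_holds

/-- **Cuneo–Eckmann–Hairer–Rey-Bellet 2018, the smooth-density fact for the pinned chain —
the named fact `CuneoEckmannHairerReyBellet2018_smoothDensity` DISCHARGED**: every finite measure
annihilated by the generator of the pinned chain on `C_c^∞` has a smooth density, by Hörmander's
theorem (`Hormander1967_thm11`, proved in `Literature/Analysis/Hypoelliptic/HormanderProof.lean`)
applied through `CuneoEckmannHairerReyBellet2018_smoothDensity_of_hormander` (CEHR Prop. 4.1).
[cite: CuneoEckmannHairerReyBellet2018, Prop. 4.1] -/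
theorem CuneoEckmannHairerReyBellet2018_smoothDensity_holds : CuneoEckmannHairerReyBellet2018_smoothDensity :=
  CuneoEckmannHairerReyBellet2018_smoothDensity_of_hormander
    Literature.Analysis.Hypoelliptic.hormander1967_thm11_proof

end Literature.MathematicalPhysics.KineticTheory.HeatConduction
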